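import Summits.AnomalousDissipation.AnomalousDissipation.Theses.TameRoughRigidity
import Summits.AnomalousDissipation.AnomalousDissipation.Theorems.GPStatisticalRigidity.Negative.EulerSSS
import Summits.AnomalousDissipation.AnomalousDissipation.Theorems.GPEulerCoercive.Negative.RestState
import Summits.AnomalousDissipation.AnomalousDissipation.Theorems.EnsembleRigidityGPStatisticalRigidityDesaturation

/-!
# Disproof of `GPEulerCoercive` (N, stmt-AnomalousDissipation-18400) — findings

cdisprove seat `refuter-cdisprove-stmt-AnomalousDissipation-18400-0`, cycle 1 (2026-08-17). VERDICT OF THE CYCLE: **no kill**.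
`N = ∀ μ, ¬ IsStationaryStatisticalSolution 0 f_GP μ` (no finite-mean-enstrophy stationary statistical solution of
EULER forced by `f_GP = sin(2πx₂)e₀ + sin(2πx₀)e₁ + sin(2πx₁)e₂`) resists every cheap attack for the structural reason
of §4; what IS kernel-checked lives in the two Negative files of this seat (proposals p162077, p162335 — import them
once landed; until then this file only points at them) and in the predecessors' files it imports.

## §1 Load-bearing analysis (file `Theorems/GPEulerCoercive/Negative/LoadBearing.lean`, p162077, rc 0, 0 sorry,
axioms propext/Classical.choice/Quot.sound)
At `ν = 0` the FMRT structure is prob ∧ fin ∧ liouville ∧ shell (clauses written out verbatim there). Since `N` NEGATES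
the conjunction, dropping a clause STRENGTHENS `N`; "load-bearing" = the strengthened statement is false.
* prob — LOAD-BEARING: `gpEulerCoercive_false_without_prob` (zero measure).
* liouville — LOAD-BEARING: `gpEulerCoercive_false_without_liouville` (Dirac at rest; `(0,f) = 0`).
* shell — **NOT load-bearing, PROVED**: `gpEulerCoercive_iff_withoutShell : N ↔ ∀ μ, ¬(prob ∧ fin ∧ liouville)` and the
  curried `gpEulerCoercive_iff_noLiouville`. Mechanism (`isSSS_symmetrize`, any force): forced Euler is time-reversible,
  `⟨F(−u), w⟩ = ⟨F(u), w⟩` and the reflected functional `Φ̃ = Φ∘(−)` has `Φ̃' (u) = −Φ'(−u)`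
  (`desaturation_exists_reflect`, landed for the parent), so `(−)_*μ` kills every generator image when `μ` does; the
  enstrophy density is even, the work `(u,f)` odd, the shells even ⇒ `μˢ = ½μ + ½(−)_*μ` is a full FMRT statistics with
  ZERO shell work (`shellWork_symmetrize_eq_zero`). Consequences for provers: no shell multiplier can ever help a
  certificate for `N`; WLOG an Euler statistics of `f_GP` is EVEN (`exists_even_sss_of_not_gpEulerCoercive`); the line's
  weak duality W needs exactly prob ∧ fin ∧ liouville — nothing is lost.
* fin — load-bearing in spirit (its deletion admits Dirac masses at wild convex-integration steady states of forced
  Euler, Buckmaster–Vicol class, infinite enstrophy); not constructible in the tree, no lemma.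
* pin `f = f_GP` — load-bearing (`RestState.not_eulerCoercive_all_forces`: `f = 0` carries `δ₀`).
* kill switch in N's words: `not_gpEulerCoercive_iff` (¬N ↔ ∃ Euler SSS of f_GP), `not_gpEulerCoercive_of_steadyWeakEuler`
  (ONE `u ∈ V = H ∩ H¹` with `IsSteadyWeakSolution 0 f_GP u` suffices — finite enstrophy only, any energy),
  `not_gpStatisticalRigidity_of_not_gpEulerCoercive` (¬N kills the route target X too).

## §2 Targets — the picked line `floor_duality_galerkin` (W, T, T′ landed by the lead; L reshaped to L′ = `stub_galerkinLadderLocal`, OPEN)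
* T audited: `galerkinIndex M = {0 < |k|² ≤ M²}` ⇒ tail gap `λ_M = 4π²(M²+1)` ✓; polarisation `|⟨sym∇w z,y⟩| ≤ S|z||y|` ✓;
  `Ψ.grad v = Ψ.grad (P_M v)` from `hlow` ✓ — no misstatement (and it landed, p159129).
* L (global strain budget) — the RAY TEST this seat found independently of the lead: along `y = A·e_k` (single Stokes
  mode, `B(e_k,e_k) = 0`, `Ψ'(A e_k)` eventually `0` or the constant `Ψ'(0)`) the rung needs `S²/(λ_M − S) ≤ 4π²|k|²`,
  binding on shell 1: `S ≤ 2π(√(π² + λ_M) − π) ≈ 4π²(√(M² + 5/4) − ½)`; with `(f_GP, Ψ'(0)) ≥ Γ` and Korn on `T³` for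
  solenoidal `w` (`‖∇w‖²₂ = 2‖sym∇w‖²₂ ≤ 4S²`, trace-free symmetric `3×3` with spectrum in `[−S,S]` has Frobenius² ≤ 2S²)
  `Γ ≤ 2‖f_GP‖_{Ḣ⁻¹} S ≈ 0.39 S`, so rungs of resolution `M` stop at `Γ ≲ 15.4(√(M²+1.25) − ½)` — linear in `M`.
  The lead's reshape L′ (state-dependent budget `S(y)`, penalty vanishing where `Ψ` is silent, test fields allowed to
  span `galerkinSpace M`) removes exactly this obstruction; the y = 0 test survives as `Γ ≤ 2‖f_GP‖_{Ḣ⁻¹}·S(0) < 0.39·λ_M`,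
  i.e. `M(Γ) ≥ √(Γ/15.4 − 1)` (growth, not a kill; by design `M(Γ) → ∞`).
* L′ — NECESSARY CONDITION KERNEL-CHECKED (file `Theorems/GPEulerCoercive/Negative/GalerkinLadderCool.lean`, p162335,
  rc 0, 0 sorry): `galerkinCertificate_le_meanEnstrophy` — a probability measure `ρ` on `H` carried by `galerkinSpace M`,
  of finite mean enstrophy, annihilating the generator image of the certificate's own `Ψ` (every invariant probability
  measure of the `M`-Galerkin forced Euler ODE with finite second moment does, for every low-mode `Ψ`) has
  `∫‖∇y‖² dρ ≥ Γ`; `no_galerkinCertificate_of_cool`; `not_galerkinLadderLocal_of_coolFamily` — a UNIFORMLY COOL family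
  `(ρ_M)` of weakly invariant probability measures of the truncations (`∫‖∇y‖² dρ_M < Γ₀ ∀ M`) refutes the conclusion of
  L′ at `Γ₀` verbatim. This is the falsifier shape of the line; §3 hunts it numerically.
* L′ is NOT refuted: at `M = 1` there is no invariant probability measure at all (`ẏ = f_GP`); for `M ≥ 2` the only
  invariant measures known are the census' steady dodgers, which heat up (`G_min = 82 → 436` over `|k|² ≤ 2 … 14`,
  j020739) — far above the landed rung `3π`.

## §3 Numerical record (this seat; results attach to the item as `compute-<job>.json`)
* kit j026015 (`rpo/job.py`, 16 cores, ≤ 3 h, `--workitem`; smoke j025742): REVERSIBLE PERIODIC ORBITS of Galerkin forced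
  Euler `u̇ = P_Q f_GP − P_Q P[(u·∇)u]` on `0 < |k|² ≤ Q`, `Q ∈ {4 (= M 2), 2, 3, 9 (= M 3)}`, exact-dealiased
  pseudo-spectral RHS (grid 16³), RK4. The truncations are REVERSIBLE under `S = (t ↦ −t) ∘ (x ↦ −x)` (Fourier:
  `û_k ↦ conj û_k`; `F(Su) = −S F(u)` because `f_GP` is odd and `B` of an even field is odd), and `Fix S` = cosine fields has
  HALF the dimension, so `S`-symmetric periodic orbits come in ONE-PARAMETER FAMILIES (`u(0), u(τ) ∈ Fix S` ⇒ period `2τ`):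
  for fixed `τ` a SQUARE shooting system `Im û(τ; a) = 0`, solved by Levenberg–Marquardt with batched finite-difference
  Jacobians from random cool starts (`E₀ ∈ {0.5,1,2,4}`, `τ ∈ {0.3,…,2.5}`); plus EVEN steady dodgers `Im F(a) = 0` (square).
  READ: `outputs/summary.json` / stdout `COOLEST Q=…`: coolest RPO mean enstrophy `Ḡ(Q)` vs coolest even steady `G(Q)`.
  Decision rule: RPOs markedly cooler than the steady census and flat in `Q` ⇒ cool invariant measures beyond steady states
  exist (L′ needs `M(Γ)` beyond them — tabulate before any SOS attempt); none / heating with `Q` ⇒ the necessary condition of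
  L′ is supported at these resolutions. (Queued at publication time; digest appended in §3′ when it returns.)

## §4 Why N resists (briefing; cf. parent Disproof.lean §8 and STRATEGY-CENSUS)
(a) ¬N ⇔ ONE finite-enstrophy stationary Euler statistics of `f_GP` (§1 kill switch) — an OPEN existence problem
(FGHV arXiv:1404.1098 §2.3). WLOG even, zero shell work (§1). Candidates and why each is out of reach:
* Dirac at an exact steady dodger `u ∈ V`, `P(u·∇u) = f_GP`: no finite-mode dodger on any searched support (parent §7 A–C,
  hand proof "no 2-shell Beltrami dodger", census `|k|² ≤ 14` spill ≥ 0.15); `f_GP` is FRUSTRATED for shears (each axis has a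
  component that is a pure function of that coordinate) and 70 %-obstructed in the ABC class `(F₀(x₁,x₂),F₁(x₂,x₀),F₂(x₀,x₁))`;
  the range test puts `f_GP` in the `H⁻¹`-closure of `L_V(H^{1−})` at silent ABC hosts with a borderline NON-`H¹` response
  (`r(M) ~ M^{-2/3}`, `‖∇W‖ ~ k_max^{0.3}`) — near-statistics at energy → ∞, never an exact one.
* finitely supported / finite-dimensional `μ`: the Liouville identity for ALL cylindrical `Φ` localises (bump profiles) —
  atoms must be exact steady states, finite-dimensional supports genuine invariant manifolds with tangential drift
  (STRATEGY-CENSUS F4); exact finite-mode time-dependent forced-Euler motions of `f_GP` do not exist on shell 1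
  (`B ≡ 0` there, `ẏ = f_GP` drifts) and are not known anywhere else.
* Gaussian / Gibbs `N(m, C)`: the `μ`-divergence of `F` is a cubic polynomial in the fluctuation whose degree-1 part
  forces `B(m,m) = f_GP` (an exact dodger again) and whose degree-3 part forces equipartition `C ∝ I` on every triad-connected
  component (infinite energy) — dead (parent §8(e), re-derived here).
* orbit measures of recurrent finite-enstrophy forced-Euler motions (periodic / quasi-periodic): around rest the linearised
  problem is `∂_t w = f_GP` (secular, nothing to rectify); around a steady host `V` it is the small-divisor problem for
  `L_V` at ZERO drift (Baldi–Montalto need a Diophantine time-quasi-periodic force; ours is static) — no construction.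
(b) The only hypothesis with slack is shell (idle, §1); prob and liouville are sharp; fin is the class boundary
(Buckmaster–Vicol evaded by it). No degenerate instance (zero measure, `δ₀`, `δ_{c f_GP}` — `P[(f·∇)f] ≠ 0` —, Beltrami
Diracs — `(f_GP, Φ'(u)) ≢ 0`) slips through.
(c) For the NEXT disprover cycle: (i) digest j026015; if cool RPO families appear at `Q = 4, 9`, continue them in `Q`
(the K-uniformly-cool family is the one object that kills L′ in Lean via `not_galerkinLadderLocal_of_coolFamily` once
made rigorous by interval Floquet enclosures — and, with TameClosure, bears on N); (ii) harmonic-balance continuation of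
the Lyapunov families at the census' EVEN steady dodgers (symmetric equilibria of a reversible system carry one-parameter
families of symmetric periodic orbits through each elliptic pair); (iii) the first-moment constraint
`div E_μ[u⊗u] + ∇p = f_GP` with `E_μ[b(v,v,f_GP) | (v,f_GP)] ≡ 3/2` (parent §8(e)) as the cheapest test any proposed
statistics must pass.
-/

noncomputable section

open MeasureTheory UnitAddTorus
open scoped InnerProductSpace ENNReal

set_option linter.dupNamespace false

namespace Summit.AnomalousDissipation.AnomalousDissipation.Cruxes.GPEulerCoercive.Disproof

open Literature.Analysis.FunctionSpaces Literature.Analysis.FunctionSpaces.Torus Literature.Analysis.FluidPDE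
open Summit.AnomalousDissipation.AnomalousDissipation.Theses.TameRoughRigidity
open Summit.AnomalousDissipation.AnomalousDissipation.Theorems.GPStatisticalRigidity.Negative

/-! ## Checked restatements available before p162077 / p162335 land -/

/-- The crux at the pinned force (the form every attack uses). -/
theorem crux_iff :
    GPEulerCoercive ↔ ∀ μ : Measure (Torus.energySpace (Fin 3)),
      ¬ Torus.IsStationaryStatisticalSolution 0 gpForce μ :=
  ⟨fun h μ => h gpForce rfl μ, fun h f hf μ => by subst hf; exact h μ⟩

/-- KILL SWITCH: one steady `H`-weak Euler state of `f_GP` in `V` (finite enstrophy, any energy) refutes the crux. -/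
theorem not_crux_of_steadyWeakEuler {u : Torus.energySpace (Fin 3)}
    (hV : (u : Lp (EuclideanSpace ℝ (Fin 3)) 2 (volume : Measure (UnitAddTorus (Fin 3)))) ∈ Torus.energySpaceV (Fin 3))
    (hu : Torus.IsSteadyWeakSolution 0 gpForce u) : ¬ GPEulerCoercive := fun h =>
  crux_iff.mp h _ (Torus.isStationaryStatisticalSolution_dirac_holds le_rfl memLp_gpForce (by simp) hV hu)

/-- The conclusion shape is not junk-true: the FMRT forced-Euler class is inhabited (rest state, zero force;
landed `RestState`), so the pin is what carries `N`. -/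
example : Torus.IsStationaryStatisticalSolution 0 (0 : UnitAddTorus (Fin 3) → EuclideanSpace ℝ (Fin 3))
    (Measure.dirac (0 : Torus.energySpace (Fin 3))) :=
  Summit.AnomalousDissipation.AnomalousDissipation.Theorems.GPEulerCoercive.Negative.isStationaryStatisticalSolution_rest

/-- Time reversal at the level of one test field (landed for the parent; the engine of §1's symmetrisation):
`⟨F(−u), w⟩ = ⟨F(u), w⟩`. -/
example (f : UnitAddTorus (Fin 3) → EuclideanSpace ℝ (Fin 3)) (u : Torus.energySpace (Fin 3))
    (w : UnitAddTorus (Fin 3) → EuclideanSpace ℝ (Fin 3)) :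
    Torus.nsGeneratorPairing 0 f (-u) w = Torus.nsGeneratorPairing 0 f u w :=
  Summit.AnomalousDissipation.AnomalousDissipation.Theorems.EnsembleRigidity.GPStatisticalRigidity.desaturation_generator_neg_left f u w

end Summit.AnomalousDissipation.AnomalousDissipation.Cruxes.GPEulerCoercive.Disproof
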